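import Literature.Probability.LatticeModels.BattleFederbushExpansion
import Mathlib.RingTheory.Nilpotent.Exp
import HarnessLib

/-!
# The Battle–Brydges–Federbush expansion of an exponential of commuting nilpotents

Topic `Literature/Probability/LatticeModels` (cluster-expansion technology; consumed by the
operator form of the fermionic tree expansion,
`MathematicalPhysics/QuantumLattice/GrassmannLaplacianTreeExpansion.lean`).

Let `A` be a commutative `ℚ`-algebra and `D : Sym2 ι → A` a family of NILPOTENT elements indexed by
the unordered pairs of a finite set `ι` of points (in the application: the pair Laplacians
`Δ_{C|ℓ}` of a cluster decomposition, which commute and are nilpotent, inside the commutative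
algebra they generate).  The **interpolated exponential** `𝔈 = exp (Σ_ℓ s_ℓ D_ℓ)` is a polynomial in
the pair variables `s_ℓ` with `∂_{s_ℓ} 𝔈 = D_ℓ 𝔈` (`pderiv_interpExp`), so the algebraic peeling
formula `Script.eval_one_eq_sum_term` of `BattleFederbushExpansion.lean` applied to `f = 𝔈` reads
(**`exp_sum_eq_sum_treeFactor_mul_expOut`**; Mastropietro 2008, §2.8 (2.91)–(2.99) with `e^{-V}`,
`V = Σ_ℓ V_ℓ`, here for `e^{+Σ D_ℓ}`):

`exp (Σ_ℓ D_ℓ) = Σ_{valid scripts s} treeFactor D s · exp (Σ_{ℓ outside Q_s} D_ℓ)`,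

where `Q_s` is the point set of `s` and the **tree factor** of a script is
`treeFactor D s = ∫_{[0,1]^ι} w_s(t) (∏_{ℓ ∈ lines s} D_ℓ) exp (Σ_{ℓ inside Q_s} σ_s(t)_ℓ D_ℓ) dt`
(`Script.treeFactor`, the formal cube integral of `Script.treeFactorPoly`): at the decoupled point
`σ_s` the pairs crossing `∂Q_s` are switched off, the pairs inside carry the interpolation
monomials and the pairs outside are fully on, and the exponential FACTORISES accordingly
(`aeval_decPt_interpExp`).  Also: naturality of everything under ring homomorphisms
(`map_treeFactor`, `map_expOut`; used to locate the tree factor in the subalgebra generated by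
the `D_ℓ`, `ℓ ⊆ Q_s`), `treeFactor_congr` (only the `D_ℓ` with `ℓ ⊆ Q_s` enter), and the chain rule
`derivation_exp` for nilpotent exponentials.  Everything is proved; no named fact.

## Sources

V. Mastropietro, *Non-Perturbative Renormalization* (World Scientific, 2008), §2.8 (2.83)–(2.99)
(bib key `Mastropietro2008`); G. A. Battle, P. Federbush, Lett. Math. Phys. 8 (1984) 55–57
(`BattleFederbush1984`); D. C. Brydges, Les Houches 1984 (`Brydges1986`); D. C. Brydges,
T. Kennedy, J. Stat. Phys. 48 (1987) 19 (the exponential form of the interpolation).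
-/

noncomputable section

open MvPolynomial Finsupp Literature.RingTheory.MvPolynomial

namespace Literature.Probability.LatticeModels

namespace BattleFederbush

/-! ### A derivation differentiates a nilpotent exponential by the chain rule -/

section DerivationExp

variable {S B : Type*} [CommRing S] [CommRing B] [Algebra S B] [Module ℚ B]

/-- **Chain rule for a nilpotent exponential**: `D (exp a) = exp a · D a` for a derivation `D` of a
commutative `ℚ`-algebra and a nilpotent `a` (the top term `a^{k-1} D a / (k-1)!` of the truncated
series is `D (a^k / k!) = 0`). [folklore] -/
theorem derivation_exp (D : Derivation S B B) {a : B} (ha : IsNilpotent a) :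
    D (IsNilpotent.exp a) = IsNilpotent.exp a * D a := by
  obtain ⟨k, hk⟩ := ha
  have hk1 : a ^ (k + 1) = 0 := by rw [pow_succ, hk, zero_mul]
  conv_lhs => rw [IsNilpotent.exp_eq_sum hk1]
  rw [IsNilpotent.exp_eq_sum hk, map_sum, Finset.sum_mul, Finset.sum_range_succ', pow_zero, map_rat_smul D,
    Derivation.map_one_eq_zero, smul_zero, add_zero]
  refine Finset.sum_congr rfl fun n _ => ?_
  rw [map_rat_smul D, Derivation.leibniz_pow, Nat.add_sub_cancel, smul_eq_mul, smul_mul_assoc,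
    ← Nat.cast_smul_eq_nsmul ℚ, smul_smul]
  congr 1
  rw [Nat.factorial_succ, Nat.cast_mul, mul_inv, mul_comm ((n + 1 : ℕ) : ℚ)⁻¹, mul_assoc,
    inv_mul_cancel₀ (by exact_mod_cast Nat.succ_ne_zero n), mul_one]

end DerivationExp

/-! ### Pairs inside / outside a point set -/

section InsideOutside

variable {ι : Type*} [DecidableEq ι]

/-- The pair `ℓ = {a, b}` lies **inside** `Q`: both endpoints are in `Q`. [folklore] -/
def insideB (Q : Finset ι) : Sym2 ι → Bool :=
  Sym2.lift ⟨fun a b => decide (a ∈ Q) && decide (b ∈ Q), fun _ _ => Bool.and_comm _ _⟩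

/-- The pair `ℓ = {a, b}` lies **outside** `Q`: both endpoints are outside `Q`. [folklore] -/
def outsideB (Q : Finset ι) : Sym2 ι → Bool :=
  Sym2.lift ⟨fun a b => !decide (a ∈ Q) && !decide (b ∈ Q), fun _ _ => Bool.and_comm _ _⟩

/-- Unfolding `insideB`. [folklore] -/
@[simp] theorem insideB_mk (Q : Finset ι) (a b : ι) :
    insideB Q s(a, b) = (decide (a ∈ Q) && decide (b ∈ Q)) := rfl

/-- Unfolding `outsideB`. [folklore] -/
@[simp] theorem outsideB_mk (Q : Finset ι) (a b : ι) :
    outsideB Q s(a, b) = (!decide (a ∈ Q) && !decide (b ∈ Q)) := rfl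

/-- `ℓ` is inside `Q` iff all its endpoints lie in `Q`. [folklore] -/
theorem insideB_eq_true_iff (Q : Finset ι) (ℓ : Sym2 ι) : insideB Q ℓ = true ↔ ∀ w ∈ ℓ, w ∈ Q := by
  induction ℓ using Sym2.inductionOn with
  | hf a b => simp [Sym2.mem_iff]

/-- `ℓ` is outside `Q` iff none of its endpoints lies in `Q`. [folklore] -/
theorem outsideB_eq_true_iff (Q : Finset ι) (ℓ : Sym2 ι) : outsideB Q ℓ = true ↔ ∀ w ∈ ℓ, w ∉ Q := by
  induction ℓ using Sym2.inductionOn with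
  | hf a b => simp [Sym2.mem_iff]

/-- A pair outside `Q` is not inside `Q`. [folklore] -/
theorem insideB_eq_false_of_outsideB {Q : Finset ι} {ℓ : Sym2 ι} (h : outsideB Q ℓ = true) :
    insideB Q ℓ = false := by
  induction ℓ using Sym2.inductionOn with
  | hf a b =>
    simp only [outsideB_mk, Bool.and_eq_true, Bool.not_eq_true', decide_eq_false_iff_not] at h
    simp [h.1]

end InsideOutside

/-! ### The interpolated exponential `𝔈 = exp (Σ_ℓ s_ℓ D_ℓ)` -/

section InterpExp

variable {ι : Type*} {A : Type*} [CommRing A] (D : Sym2 ι → A)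

/-- A finite sum `Σ c_ℓ D_ℓ` of multiples of nilpotent elements of a commutative ring is nilpotent.
[folklore] -/
theorem isNilpotent_sum_mul {B : Type*} [CommRing B] [Algebra A B] (hD : ∀ ℓ, IsNilpotent (D ℓ))
    (S : Finset (Sym2 ι)) (c : Sym2 ι → B) :
    IsNilpotent (∑ ℓ ∈ S, c ℓ * algebraMap A B (D ℓ)) :=
  Commute.isNilpotent_sum (fun ℓ _ => (Commute.all _ _).isNilpotent_mul_left ((hD ℓ).map _))
    fun _ _ _ _ => Commute.all _ _

variable [Fintype ι]

/-- The linear form `Σ_ℓ s_ℓ D_ℓ` in the pair variables. [folklore] -/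
def interpForm : MvPolynomial (Sym2 ι) A := ∑ ℓ : Sym2 ι, X ℓ * C (D ℓ)

variable {D} in
/-- The exponent is nilpotent. [folklore] -/
theorem isNilpotent_interpForm (hD : ∀ ℓ, IsNilpotent (D ℓ)) : IsNilpotent (interpForm D) :=
  isNilpotent_sum_mul D hD _ _

variable [Algebra ℚ A]

/-- The **interpolated exponential** `𝔈 = exp (Σ_ℓ s_ℓ D_ℓ)`, a polynomial in the pair variables
(Mastropietro 2008, (2.83)–(2.85): `e^{-V(t)}`, `V(t) = Σ_ℓ t(ℓ) V_ℓ`). [folklore] -/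
def interpExp : MvPolynomial (Sym2 ι) A := IsNilpotent.exp (interpForm D)

variable {D} [DecidableEq ι]

/-- **`∂_{s_ℓ} 𝔈 = D_ℓ · 𝔈`** (Mastropietro 2008, (2.85)). [folklore] -/
theorem pderiv_interpExp (hD : ∀ ℓ, IsNilpotent (D ℓ)) (ℓ : Sym2 ι) :
    pderiv ℓ (interpExp D) = C (D ℓ) * interpExp D := by
  rw [interpExp, derivation_exp (pderiv ℓ) (isNilpotent_interpForm hD), mul_comm]
  congr 1
  rw [interpForm, map_sum, Finset.sum_eq_single ℓ]
  · rw [Derivation.leibniz, pderiv_C, smul_zero, zero_add, pderiv_X, Pi.single_eq_same, smul_eq_mul, mul_one]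
  · intro ℓ' _ hne
    rw [Derivation.leibniz, pderiv_C, smul_zero, zero_add, pderiv_X, Pi.single_eq_of_ne hne, smul_zero]
  · intro h; exact absurd (Finset.mem_univ ℓ) h

/-- **Iterated line derivatives extract the product of the `D`'s of the lines**:
`∂_{ℓ_k} ⋯ ∂_{ℓ_1} 𝔈 = (∏_j D_{ℓ_j}) · 𝔈` (Mastropietro 2008, (2.110)–(2.113)). [folklore] -/
theorem listDeriv_interpExp (hD : ∀ ℓ, IsNilpotent (D ℓ)) (L : List (Sym2 ι)) :
    listDeriv L (interpExp D) = C ((L.map D).prod) * interpExp D := by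
  induction L with
  | nil => rw [listDeriv_nil, List.map_nil, List.prod_nil, C_1, one_mul]
  | cons ℓ L ih =>
    rw [listDeriv_cons, pderiv_interpExp hD, listDeriv_C_mul, ih, ← mul_assoc, ← C_mul, List.map_cons,
      List.prod_cons, mul_comm (D ℓ)]

omit [DecidableEq ι] in
/-- The exponential passes through the evaluation maps of the polynomial ring. [folklore] -/
theorem aeval_interpExp (hD : ∀ ℓ, IsNilpotent (D ℓ)) {B : Type*} [CommRing B] [Algebra A B] [Algebra ℚ B]
    (p : Sym2 ι → B) :
    aeval p (interpExp D) = IsNilpotent.exp (∑ ℓ : Sym2 ι, p ℓ * algebraMap A B (D ℓ)) := by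
  rw [interpExp, (isNilpotent_interpForm hD).map_exp (aeval p), interpForm, map_sum]
  congr 1
  refine Finset.sum_congr rfl fun ℓ _ => ?_
  rw [map_mul, aeval_X, aeval_C]

omit [DecidableEq ι] in
/-- **`𝔈(1) = exp (Σ_ℓ D_ℓ)`.** [folklore] -/
theorem eval_one_interpExp (hD : ∀ ℓ, IsNilpotent (D ℓ)) :
    eval (fun _ => (1 : A)) (interpExp D) = IsNilpotent.exp (∑ ℓ : Sym2 ι, D ℓ) := by
  have h := aeval_interpExp hD (fun _ => (1 : A))
  simp only [one_mul, Algebra.algebraMap_self, RingHom.id_apply] at h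
  exact h

end InterpExp

/-! ### The decoupled point: inside, outside and crossing pairs -/

namespace Script

variable {ι : Type*} [DecidableEq ι] {root : ι} {k : ℕ} {R : Type*} [CommRing R]

/-- At the decoupled point a pair inside the point set of the script keeps its live value.
[folklore] -/
theorem decPt_mk_of_mem_of_mem (s : Script root k) {a b : ι}
    (ha : a ∈ Finset.univ.image s.y) (hb : b ∈ Finset.univ.image s.y) : decPt R s s(a, b) = livePt R s s(a, b) := by
  rw [decPt, if_neg]
  rw [pre_eq_image s le_rfl, crossB_mk]
  simp [ha, hb]

/-- **The decoupled point, pair by pair**: live value inside the point set `Q`, `1` outside, `0`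
across its boundary (Mastropietro 2008, (2.90)). [folklore] -/
theorem decPt_eq (s : Script root k) (ℓ : Sym2 ι) :
    decPt R s ℓ = if insideB (Finset.univ.image s.y) ℓ = true then livePt R s ℓ
      else if outsideB (Finset.univ.image s.y) ℓ = true then 1 else 0 := by
  induction ℓ using Sym2.inductionOn with
  | hf a b =>
    by_cases ha : a ∈ Finset.univ.image s.y <;> by_cases hb : b ∈ Finset.univ.image s.y
    · rw [decPt_mk_of_mem_of_mem s ha hb, if_pos (by simp [ha, hb])]
    · rw [decPt_mk_of_mem_of_notMem R s ha hb, if_neg (by simp [hb]), if_neg (by simp [ha])]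
    · rw [Sym2.eq_swap, decPt_mk_of_mem_of_notMem R s hb ha, if_neg (by simp [ha]), if_neg (by simp [hb])]
    · rw [decPt_mk_of_notMem R s ha hb, if_neg (by simp [ha]), if_pos (by simp [ha, hb])]

variable [Fintype ι] {A : Type*} [CommRing A] (D : Sym2 ι → A)

/-- The **inner form** of a script: `Σ_{ℓ inside Q_s} σ_s(ℓ) D_ℓ`, the exponent of what is left of
the interpolated exponential inside the point set at the decoupled point. [folklore] -/
def innerForm (s : Script root k) : MvPolynomial ι A :=
  ∑ ℓ ∈ Finset.univ.filter (fun ℓ => insideB (Finset.univ.image s.y) ℓ = true), livePt A s ℓ * C (D ℓ)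

variable {D} in
/-- The inner form is nilpotent. [folklore] -/
theorem isNilpotent_innerForm (hD : ∀ ℓ, IsNilpotent (D ℓ)) (s : Script root k) : IsNilpotent (innerForm D s) :=
  isNilpotent_sum_mul D hD _ _

end Script

section Outer

variable {ι : Type*} [Fintype ι] [DecidableEq ι] {A : Type*} [CommRing A] (D : Sym2 ι → A)

/-- The **outer sum** `Σ_{ℓ outside Q} D_ℓ`. [folklore] -/
def outerSum (Q : Finset ι) : A := ∑ ℓ ∈ Finset.univ.filter (fun ℓ => outsideB Q ℓ = true), D ℓ

variable {D} in
/-- The outer sum is nilpotent. [folklore] -/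
theorem isNilpotent_outerSum (hD : ∀ ℓ, IsNilpotent (D ℓ)) (Q : Finset ι) : IsNilpotent (outerSum D Q) :=
  Commute.isNilpotent_sum (fun ℓ _ => hD ℓ) fun _ _ _ _ => Commute.all _ _

variable [Algebra ℚ A]

/-- The **outer exponential** `exp (Σ_{ℓ outside Q} D_ℓ)` (the decoupled factor `e^{-V(X ∖ X_r)}` of
Mastropietro 2008, (2.90)/(2.99)). [folklore] -/
def expOut (Q : Finset ι) : A := IsNilpotent.exp (outerSum D Q)

end Outer

namespace Script

variable {ι : Type*} [Fintype ι] [DecidableEq ι] {root : ι} {k : ℕ} {A : Type*} [CommRing A] [Algebra ℚ A]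
variable {D : Sym2 ι → A}

/-- **Factorisation of the interpolated exponential at the decoupled point**:
`𝔈(σ_s) = exp (Σ_{ℓ inside Q_s} σ_s(ℓ) D_ℓ) · exp (Σ_{ℓ outside Q_s} D_ℓ)` — the crossing pairs are
switched off (Mastropietro 2008, (2.90): `W_X(X₂,t₂)|_{t₂=0} + V(X ∖ X₂)`). [folklore] -/
theorem aeval_decPt_interpExp (hD : ∀ ℓ, IsNilpotent (D ℓ)) (s : Script root k) :
    aeval (decPt A s) (interpExp D) =
      IsNilpotent.exp (innerForm D s) * C (expOut D (Finset.univ.image s.y)) := by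
  set Q := Finset.univ.image s.y with hQ
  rw [aeval_interpExp hD, MvPolynomial.algebraMap_eq]
  have hsplit : ∑ ℓ : Sym2 ι, decPt A s ℓ * C (D ℓ) = innerForm D s + C (outerSum D Q) := by
    rw [innerForm, outerSum, map_sum, Finset.sum_filter, Finset.sum_filter, ← Finset.sum_add_distrib]
    refine Finset.sum_congr rfl fun ℓ _ => ?_
    rw [decPt_eq]
    by_cases hin : insideB Q ℓ = true
    · rw [if_pos hin, if_pos hin, if_neg, add_zero]
      intro hout
      rw [insideB_eq_false_of_outsideB hout] at hin
      exact Bool.false_ne_true hin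
    · rw [if_neg hin, if_neg hin, zero_add]
      split_ifs
      · rw [one_mul]
      · rw [zero_mul]
  rw [hsplit, IsNilpotent.exp_add_of_commute (Commute.all _ _) (isNilpotent_innerForm hD s)
    (((isNilpotent_outerSum hD Q).map C)), expOut, (isNilpotent_outerSum hD Q).map_exp C]

variable (D)

/-- The **tree-factor polynomial** of a script:
`w_s(t) · (∏_{ℓ ∈ lines s} D_ℓ) · exp (Σ_{ℓ inside Q_s} σ_s(t)_ℓ D_ℓ)`. [folklore] -/
def treeFactorPoly (s : Script root k) : MvPolynomial ι A :=
  weight A s * C ((s.lines.map D).prod) * IsNilpotent.exp (innerForm D s)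

/-- The **tree factor** of a script: `∫_{[0,1]^ι} w_s(t) (∏_{ℓ ∈ lines s} D_ℓ) exp (Σ_{ℓ ⊆ Q_s} σ_s(t)_ℓ D_ℓ) dt`
(Mastropietro 2008, (2.93)/(2.98): one term of `K(X_r)`). [folklore] -/
def treeFactor (s : Script root k) : A := cubeIntegral ι A (treeFactorPoly D s)

omit [DecidableEq ι] in
/-- The cube integral is linear over the coefficient ring: `∫ P · a = (∫ P) · a`. [folklore] -/
theorem cubeIntegral_mul_C (P : MvPolynomial ι A) (a : A) :
    cubeIntegral ι A (P * C a) = cubeIntegral ι A P * a := by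
  rw [mul_comm, ← smul_eq_C_mul, map_smul, smul_eq_mul, mul_comm]

variable {D}

/-- **The term of a valid script in the peeling expansion of `𝔈`** is the tree factor times the
outer exponential: `∫ w_s (∂^s 𝔈)(σ_s) = treeFactor D s · exp (Σ_{ℓ outside Q_s} D_ℓ)`. [folklore] -/
theorem term_interpExp (hD : ∀ ℓ, IsNilpotent (D ℓ)) (s : Script root k) :
    term A (interpExp D) s = treeFactor D s * expOut D (Finset.univ.image s.y) := by
  rw [term, lineDeriv_eq, listDeriv_interpExp hD, map_mul (aeval (decPt A s)), aeval_C, MvPolynomial.algebraMap_eq,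
    aeval_decPt_interpExp hD, treeFactor, ← cubeIntegral_mul_C, treeFactorPoly]
  congr 1
  ring

/-- The tree factor with the line product pulled out:
`treeFactor D s = (∏_{ℓ ∈ lines s} D_ℓ) · ∫ w_s exp (inner form)`. [folklore] -/
theorem treeFactor_eq_prod_mul (s : Script root k) :
    treeFactor D s = (s.lines.map D).prod * cubeIntegral ι A (weight A s * IsNilpotent.exp (innerForm D s)) := by
  rw [treeFactor, treeFactorPoly, mul_right_comm, cubeIntegral_mul_C, mul_comm]

end Script

/-! ### The expansion -/

section Expansion

variable {ι : Type*} [Fintype ι] [DecidableEq ι] {A : Type*} [CommRing A] [Algebra ℚ A] {D : Sym2 ι → A}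

/-- **The Battle–Brydges–Federbush expansion of an exponential of commuting nilpotents**
(Mastropietro 2008, §2.8 (2.91)–(2.99), for `e^{Σ_ℓ D_ℓ}` in a commutative `ℚ`-algebra): for every
root `v`,
`exp (Σ_ℓ D_ℓ) = Σ_{k < |ι|} Σ_{valid scripts s of length k+1 rooted at v} treeFactor D s · exp (Σ_{ℓ outside Q_s} D_ℓ)`.
[cite: Mastropietro2008, §2.8 (2.91)-(2.99)] -/
theorem exp_sum_eq_sum_treeFactor_mul_expOut (hD : ∀ ℓ, IsNilpotent (D ℓ)) (v : ι) :
    IsNilpotent.exp (∑ ℓ : Sym2 ι, D ℓ) =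
      ∑ k ∈ Finset.range (Fintype.card ι), ∑ s : Script v k,
        if s.Valid then Script.treeFactor D s * expOut D (Finset.univ.image s.y) else 0 := by
  rw [← eval_one_interpExp hD, Script.eval_one_eq_sum_term (root := v)]
  refine Finset.sum_congr rfl fun k _ => Finset.sum_congr rfl fun s _ => ?_
  split_ifs
  · exact Script.term_interpExp hD s
  · rfl

end Expansion

/-! ### Naturality under ring homomorphisms, and dependence on the inside pairs only -/

section Naturality

variable {ι : Type*} [Fintype ι] {A B : Type*} [CommRing A] [Algebra ℚ A] [CommRing B] [Algebra ℚ B]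
  (φ : A →+* B)

/-- **The formal cube integral is natural**: `∫ (φ P) dt = φ (∫ P dt)`. [folklore] -/
theorem cubeIntegral_map (P : MvPolynomial ι A) :
    cubeIntegral ι B (MvPolynomial.map φ P) = φ (cubeIntegral ι A P) := by
  induction P using MvPolynomial.induction_on' with
  | monomial d a =>
    rw [map_monomial, cubeIntegral_monomial, cubeIntegral_monomial, map_mul]
    congr 1
    rw [Algebra.algebraMap_eq_smul_one, Algebra.algebraMap_eq_smul_one, map_rat_smul φ, map_one]
  | add p q hp hq => rw [map_add, map_add, map_add, hp, hq, map_add]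

variable [DecidableEq ι] (D : Sym2 ι → A)

omit [Algebra ℚ A] [Algebra ℚ B] in
/-- Naturality of the outer sum. [folklore] -/
theorem map_outerSum (Q : Finset ι) : φ (outerSum D Q) = outerSum (φ ∘ D) Q := by
  rw [outerSum, outerSum, map_sum]
  rfl

/-- **Naturality of the outer exponential.** [folklore] -/
theorem map_expOut (hD : ∀ ℓ, IsNilpotent (D ℓ)) (Q : Finset ι) : φ (expOut D Q) = expOut (φ ∘ D) Q := by
  rw [expOut, (isNilpotent_outerSum hD Q).map_exp φ, map_outerSum, expOut]

variable {root : ι} {k : ℕ}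

omit [Algebra ℚ A] [Algebra ℚ B] in
/-- Naturality of the inner form. [folklore] -/
theorem map_innerForm (s : Script root k) :
    MvPolynomial.map φ (Script.innerForm D s) = Script.innerForm (φ ∘ D) s := by
  rw [Script.innerForm, Script.innerForm, map_sum]
  refine Finset.sum_congr rfl fun ℓ _ => ?_
  rw [map_mul, map_C, Script.livePt, Script.livePt, map_monomial, map_one]
  rfl

/-- Naturality of the tree-factor polynomial. [folklore] -/
theorem map_treeFactorPoly (hD : ∀ ℓ, IsNilpotent (D ℓ)) (s : Script root k) :
    MvPolynomial.map φ (Script.treeFactorPoly D s) = Script.treeFactorPoly (φ ∘ D) s := by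
  rw [Script.treeFactorPoly, Script.treeFactorPoly, map_mul, map_mul, map_C, Script.weight, Script.weight,
    map_monomial, map_one, (Script.isNilpotent_innerForm hD s).map_exp (MvPolynomial.map φ), map_innerForm,
    map_list_prod, List.map_map]

/-- **Naturality of the tree factor**: `φ (treeFactor D s) = treeFactor (φ ∘ D) s`. [folklore] -/
theorem map_treeFactor (hD : ∀ ℓ, IsNilpotent (D ℓ)) (s : Script root k) :
    φ (Script.treeFactor D s) = Script.treeFactor (φ ∘ D) s := by
  rw [Script.treeFactor, Script.treeFactor, ← cubeIntegral_map, map_treeFactorPoly φ D hD]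

variable {D}

/-- **Only the pairs inside the point set enter the tree factor**: two families agreeing on the
pairs inside `Q_s` have the same tree factor. [folklore] -/
theorem treeFactor_congr {D' : Sym2 ι → A} (s : Script root k)
    (h : ∀ ℓ, insideB (Finset.univ.image s.y) ℓ = true → D ℓ = D' ℓ) :
    Script.treeFactor D s = Script.treeFactor D' s := by
  have hlines : s.lines.map D = s.lines.map D' :=
    List.map_congr_left fun ℓ hℓ => h ℓ ((insideB_eq_true_iff _ ℓ).2 (Script.mem_image_of_mem_lines s ℓ hℓ))
  have hinner : Script.innerForm D s = Script.innerForm D' s :=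
    Finset.sum_congr rfl fun ℓ hℓ => by rw [h ℓ (Finset.mem_filter.1 hℓ).2]
  rw [Script.treeFactor, Script.treeFactor, Script.treeFactorPoly, Script.treeFactorPoly, hlines, hinner]

end Naturality

end BattleFederbush

end Literature.Probability.LatticeModels
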